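import Mathlib
import HarnessLib
import Summits.Parity.GeneralizedHardyLittlewood.Theses.PrimeDeterminantCells
import Literature.NumberTheory.Sieve.OddShiftedConvolutionBombieriA2

/-!
# Refutation of `PrimeDeterminantCells.ConvMomentLevelOne` (stmt-Parity-9541)

`Summit.Parity.GeneralizedHardyLittlewood.Theses.PrimeDeterminantCells.ConvMomentLevelOne` asserts, for
all `i j`, Bombieri's level-of-distribution hypothesis `(A₂)` (`SieveSequence.BombieriA2`: level `x^{1−ε}`,
saving `(log x)^{−B}` for EVERY `B`) for the sifted sequence
`a_m = 1_{m odd} ∑_{cd = m+2} Λ(c) logⁱc · Λ(d) logʲd` with Bombieri's counting function and the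
shifted-primes density `g(d) = 1_{(d,2)=1}/φ(d)`.

This is false already for `i = j = 0`, unconditionally: the multiplicative model `g(3) = 1/φ(3) = 1/2`
presumes that `Λ ⋆ Λ` puts no mass on multiples of `3`; in fact the pairs `(3, p)`, `(p, 3)` give the odd
multiples of `3` the mass `(log 3)·x·(1+o(1))`, a `1/log x`-proportion of `A(x) ≍ x log x`, so the remainder
`R(x; 3) = A(x; 3) − A(x)/2` is `≤ −x/10` for large `x`, while `(A₂)` with `ε = 1/2`, `B = 2`, `y_d = x`
demands `|R(x; 3)| ≤ C·A(x)/log² x ≤ 5C·x/log x`. The whole analytic argument (Selberg's formula,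
Siegel–Walfisz mod `6` with the hyperbola method, Chebyshev's `θ`-bound) is the PROVED Literature theorem
`Literature.NumberTheory.Sieve.OddShiftedConv.cmSeq_not_bombieriA2`
(`Literature/NumberTheory/Sieve/OddShiftedConvolutionBombieriA2.lean`, with
`TwistedVonMangoldtModSix.lean`); this file only instantiates the route hypothesis at `i = j = 0` with that
sequence (`cmSeq_hyp`, `cmSeq_size`, `cmSeq_density` are definitional).

The same bias `R(x; p) ≈ −2x log p/(p−1)²` occurs at every odd prime `p`; the intended hypothesis needs the
convolution restricted to factors `≥ x^η` (or an `x`-dependent / coprime-normalised main term). The route's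
supports `SeesawIdentity` and `TwoSidedLocalisation` take `ConvMomentLevelOne` as an antecedent and are
therefore vacuous as typed. Refuter route review `rreview-0815T14-0`, 2026-08-15; falsity found
independently (paper + numerics to 10⁷, `R(x;3)/x → −0.549`) by refuters g41-22, g41-19, g41-32. [folklore]
-/

namespace Summit.Parity.GeneralizedHardyLittlewood.Theses.PrimeDeterminantCells

open scoped BigOperators Topology Manifold Classical MeasureTheory ProbabilityTheory Matrix InnerProductSpace ComplexConjugate ContinuousMap
open Filter Set Function TopologicalSpace MeasureTheory

/-- **Record of the dropped route item `ConvMomentLevelOne`** = stmt-Parity-9541 (ledger signature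
verbatim, in the route file's namespace and `open` context; NOT a route item): after
`PrimeDeterminantCellsConvMomentLevelOne_refuted` (below) closed the item `refuted`, the route repair
(rev 2, `drop`) removed this constant from the gate-written Theses file, while the Theorems file below —
append-only, statement text fixed — still names it ("Unknown identifier" in the full builds of
2026-08-16). Re-declared here under its original fully-qualified name and definiens solely so that this
record keeps elaborating. FALSE (refuted below): Bombieri's `(A₂)` for `1_{m odd}(Λ logⁱ ⋆ Λ logʲ)(m+2)`
with the shifted-primes density, for all `i j`. -/
def ConvMomentLevelOne : Prop :=
  ∀ i j : ℕ, ∀ A : Literature.NumberTheory.Sieve.SieveSequence, (∀ m : ℕ, A.a m = if m % 2 = 1 then ∑ cd ∈ Nat.divisorsAntidiagonal (m + 2), ArithmeticFunction.vonMangoldt cd.1 * Real.log cd.1 ^ i * (ArithmeticFunction.vonMangoldt cd.2 * Real.log cd.2 ^ j) else 0) → (∀ x : ℝ, A.size x = A.congrSum 1 x) → A.density = Literature.NumberTheory.Sieve.shiftedPrimesDensity 2 → A.BombieriA2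

end Summit.Parity.GeneralizedHardyLittlewood.Theses.PrimeDeterminantCells

namespace Summit.Parity.GeneralizedHardyLittlewood.Theorems

open Literature.NumberTheory.Sieve.OddShiftedConv in
/-- Refutes `PrimeDeterminantCells.ConvMomentLevelOne` [refuted-misstated]: at `i = j = 0` the sequence
`1_{m odd}(Λ ⋆ Λ)(m+2)` with density `1_{(d,2)=1}/φ(d)` violates Bombieri's `(A₂)` — witness `ε = 1/2`,
`B = 2`, `y_d = x`, the single modulus `d = 3`. Repair (believed true, GEH-strength): restrict the convolution
to factors `≥ m^η` (rough convolution; then the density `1_{(d,2)=1}/φ(d)` is right), or use the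
coprime-normalised discrepancy `A(x;d) − (1/φ(d))·∑_{m ≤ x, (m+2,d)=1} a_m`; the witness does not bite the
repaired statements (their remainders have no secondary main term). [folklore] -/
theorem PrimeDeterminantCellsConvMomentLevelOne_refuted :
    ¬ Summit.Parity.GeneralizedHardyLittlewood.Theses.PrimeDeterminantCells.ConvMomentLevelOne :=
  fun h => cmSeq_not_bombieriA2 (h 0 0 cmSeq cmSeq_hyp cmSeq_size cmSeq_density)

end Summit.Parity.GeneralizedHardyLittlewood.Theorems
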